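import Summits.QuantumFields.YangMills.Theses.ParabolicTrajectory
import Summits.QuantumFields.YangMills.Theorems.BalabanStepParabolic.Negative.RescaleCoupling
import Summits.QuantumFields.YangMills.Theorems.BalabanStepParabolic.Negative.OrbitTransport
import Summits.QuantumFields.YangMills.Theorems.BalabanStepParabolic.Negative.OrbitRecursion
import Summits.QuantumFields.YangMills.Theorems.BalabanStepParabolic.Negative.EvenRedundant
import Summits.QuantumFields.YangMills.Theorems.BalabanStepParabolic.Negative.OverTunedEquivalence
import Summits.QuantumFields.YangMills.Theorems.BalabanStepParabolic.Negative.FaceContact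

/-!
# Line `logconcave-fibres-no-derivative-loss` for crux `BalabanStepParabolic` (stmt-QuantumFields-9684)

Route `ParabolicTrajectory` (YangMills). Crux (fixed, by name):
`Summit.QuantumFields.YangMills.Theses.ParabolicTrajectory.BalabanStepParabolic` =
`∀ G (compact simple Lie) r, ∃ M₀, ∀ M ≥ M₀, Nonempty (BalabanBanachStep G r M)`.

LEVER. After Bałaban's block-axial gauge fixing and with the block-averaging constraint, the
one-step fluctuation ("fibre") measures of Wilson's action are, on the small-field window and in
exponential coordinates, UNIFORMLY LOG-CONCAVE — uniformly in the volume, the background and the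
running coupling (Bałaban: the constrained action has "exactly one critical point … a minimum …
with a strictly positive second order differential", CMP 119 p. 248 quoting Thm 1 of CMP 102; the
bet of the line is that strict positivity holds on the whole window, not only at the minimiser).
Uniform log-concavity feeds two dimension-free theorems of log-concave analysis:
(i) Brascamp–Lieb ⇒ the fibre free energy is `C^{1,1}` in every Banach parameter (coupling `g`,
previous action `y`, block field `V`) with constants independent of the number of integration
variables and WITHOUT shrinking any analyticity domain ("no derivative loss") — this is what lets
ONE Banach space `E` carry the step (`lipschitz_fibre`, `lipschitz_base`, `remainder`), where
Bałaban's printed scheme maps the space with index `k` into the space with index `k+1`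
(CMP 119 p. 262, p. 277); (ii) Helffer–Sjöstrand/Combes–Thomas ⇒ fibre covariances decay
exponentially ⇒ the effective action stays quasi-local in the SAME weighted norm.
The large-field complement of the window is NOT touched by the lever: it is handled by Bałaban's
`R`-operation as printed (CMP 116/122), its weight `exp(−p(g)²/2) = O(g^∞)` paying for the
`o(g³)`-Lipschitz demand; this is the line's declared residual risk (= the crux's own
why-might-fail), carried inside `stub_convexFibreChart`.

SHAPE. Five registered stubs and the sorry-free composition `BalabanStepParabolic_of`:
* `stub_plaquetteConvexWindow`  — N-uniform second-variation bound for one plaquette weight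
  (matrix analysis; the seed of fibre convexity);
* `stub_constrainedAxialGap`    — volume-uniform coercivity of the linearised curl form on
  block-axial, block-average-free 1-forms (Bałaban's positivity, abelianised: at the trivial
  background the plaquette Hessian is the abelian one ⊗ 𝔤, traces of commutators vanishing);
* `stub_noDerivativeLoss`       — dimension-free `C^{1,1}` regularity of log-concave fibre free
  energies in a Banach parameter (Brascamp–Lieb mechanism);
* `stub_convexCovarianceDecay`  — dimension-free exponential decay of covariances for finite-range
  uniformly convex Gibbs weights (Helffer–Sjöstrand; KNOWN, vendorable as a Literature fact);
* `stub_convexFibreChart`       — HARDEST: the four inputs ⇒ a `C^{1,1}` parabolic one-chart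
  presentation of Bałaban's complete step with Wilson embedding and the pure-curvature observable
  flow (`CurvatureChart`, this file) for every compact simple `G`, `r`, `M ≥ M₀`;
and `BalabanStepParabolic_of` assembles `BalabanBanachStep` from a `CurvatureChart` by the species
reduction `CurvatureChart.toStep` (normalisations `c g s = 𝟙[s = curvature]`: strings containing a
non-curvature species are realised by `0` on both sides of (4b); proved here, no sorry). The
statements of the stubs are also recorded verbatim as the Props `Stub.stub_<name>` (head constants
sharing the stub names) so that stub 5 and the composition can take them as hypotheses under the
skeleton audit (rule (ii): every hypothesis of the skeleton theorem is a declared stub BY NAME);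
`BalabanStepParabolic_closed` feeds the sorried stubs to the composition.

NEGATIVE SIDE (landed, imported here; nothing in them refutes a stub — they are theorems about an
ARBITRARY inhabitant, hence about the output of stub 5 via `toStep`):
* `Negative.OrbitTransport` (p70637): `CurvatureChart.mom_orbit_wilson` and
  `CurvatureChart.tendsto_wilson_of_tendsto_orbit` below re-derive, for the line's own object, what
  (4a)+(4b) PIN at odd `M` — `mom` at depth `k` of a Wilson orbit IS the genuine centred plaquette
  `n`-point function at `β = betaOf g` on the torus `M^k(2L+1)` with `k`-fold dilated test functions —
  and what (4c) then COSTS: in-chart convergence of orbit points forces convergence of those data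
  (a joint continuum/thermodynamic limit along the chart's own tuning). This is the open content of
  `stub_convexFibreChart` (its field `continuousOn_mom`), stated in the kernel, not only in prose.
* `Negative.RescaleCoupling` (p70615): `CurvatureChart.b₀_unpinned` — the field `b₀` of the output is
  a chart artefact (only `κ b₀` is invariant); the line does not and cannot pin the physical one-loop
  slope in the TYPE; the intended inhabitant has it (docstring of stub 5), the crux does not ask it.
* `Negative.OrbitRecursion` (p70677): (4a) alone is free (`orbitRec`); the stub-5 prover may build
  `mom` off the Wilson orbits by that recursion from a continuous germ — the skeleton does not
  presuppose it, and (4c) at orbit accumulation points is NOT made free by it.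
Parity of `M` is irrelevant to the construction (the even half of the crux has no RG content and
is a theorem of the standing Disproof, v5 §B/§E `balabanStepParabolic_even`,
`balabanStepParabolic_iff_odd'`, unconditional but not yet landed under `Theorems/` — once landed, a
stub-5 prover may discharge even `M` by it and spend the lever on odd `M`; the odd half carries the
content above).

FOR THE LEAD. (1) The registered signatures of stubs 2 and 5 mention in-file definitions
(`IsBlockAxial`, `BlockAvgZero`, `curl`, `CurvatureChart`, `Stub.*`): before a `--supports` proof
of either lands under `Theorems/`, move these definitions VERBATIM into a sorry-free support module
(e.g. `Theorems/BalabanStepParabolic/ConvexFibre/Defs.lean`) and re-point this file's imports; the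
stub statements do not change. Stubs 1, 3, 4 are stated over Mathlib only and can be proved at
once (3 via `Literature.Analysis.FunctionSpaces.BakryEmery_poincare_of_uniformlyConvex_holds` /
`Literature.Probability.Moments.BrascampLieb1976_thm41_uniform_holds`). (2) Inside stub 5 the
natural `--supports` lemmas are: the windowed (small-field) convex step as a `C^{1,1}` self-map of
the volume-indexed space (stubs 1–4 in; no `R`), the `R`-completion with frozen thresholds
(the residual risk), `b₀ > 0` from the one-loop normal form, the Wilson embedding at `g = 0`
(Bałaban CMP 95/96), and the source-carrying step for `mom` with (4c).

Generation 2 of the crux-plan seat (2026-08-15): statements of the five stubs are UNCHANGED from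
generation 1 (skeleton sha 7673051a…, registered 23:42Z); added the imports of the three landed
Negative modules, `CurvatureChart.toStep` as a definition (was an anonymous term), and the
sorry-free corollaries `mom_orbit_wilson`, `tendsto_wilson_of_tendsto_orbit`, `b₀_unpinned`.
-/

open scoped SchwartzMap Matrix ComplexOrder BigOperators
open MeasureTheory Filter Topology
open Literature.MathematicalPhysics.AQFT Literature.MathematicalPhysics.QuantumLattice
open Literature.MathematicalPhysics.QuantumFieldTheory
open Summit.QuantumFields.YangMills.Theorems.BalabanStepParabolic

noncomputable section

namespace Summit.QuantumFields.YangMills.Cruxes.BalabanStepParabolic.LogconcaveFibresNoDerivativeLoss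

/-! ## The line's intermediate object: a `C^{1,1}` parabolic chart with curvature observables -/

/-- **Output type of the hardest stub.** Groups (1)–(3) of
`Literature.MathematicalPhysics.QuantumFieldTheory.BalabanBanachStep` VERBATIM (chart `E`, step
`φ Ψ A` with the nine-clause parabolic block, `b = b₀ log M`, basin, Wilson embedding, `betaOf`),
PLUS the two signatures of this line:
* `C^{1,1}` IN THE FIBRE ("no derivative loss"): `Ψ g ·` and `φ g ·` are Fréchet differentiable on
  the open chart ball with `‖DΨ(g,y) − A‖ ≤ C(|g| + ‖y‖)`, `‖Dφ(g,y)‖ ≤ C|g|³`;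
* the realisation of the PURE-CURVATURE strings with unit normalisation: `mom p S n f` = the
  smeared, centred, `a⁻⁴`-renormalised `n`-point function of `tr F²` in the effective theory `p`
  on the torus of `S` sites, exactly RG-covariant (4a), equal to Wilson's
  `wilsonCentredSchwinger r.ρ (betaOf g) L 1 n (curvature string) f` at the Wilson points (4b),
  continuous on the chart for off-diagonal tuples (4c).
All other species are recovered in `BalabanStepParabolic_of` with normalisation `0`. -/
structure CurvatureChart (G : Type) [Group G] [TopologicalSpace G] [IsTopologicalGroup G]
    [CompactSpace G] [MeasurableSpace G] [BorelSpace G] (r : LatticeRep G) (M : ℕ) where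
  E : Type
  [instNormedAddCommGroup : NormedAddCommGroup E]
  [instNormedSpace : NormedSpace ℝ E]
  [instCompleteSpace : CompleteSpace E]
  φ : ℝ → E → ℝ
  Ψ : ℝ → E → E
  A : E →L[ℝ] E
  b : ℝ
  θ : ℝ
  C : ℝ
  δ : ℝ
  b_pos : 0 < b
  θ_nonneg : 0 ≤ θ
  θ_lt_one : θ < 1
  C_pos : 0 < C
  δ_pos : 0 < δ
  norm_A_le : ‖A‖ ≤ θ
  remainder : ∀ g : ℝ, ∀ y : E, |g| ≤ δ → ‖y‖ ≤ δ →
    |φ g y - (g + b * g ^ 3)| ≤ C * (g ^ 4 + |g| ^ 3 * ‖y‖) ∧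
      ‖Ψ g y - A y‖ ≤ C * (g ^ 2 + ‖y‖ ^ 2)
  lipschitz_fibre : ∀ g : ℝ, ∀ y y' : E, |g| ≤ δ → ‖y‖ ≤ δ → ‖y'‖ ≤ δ →
    |φ g y - φ g y'| ≤ C * |g| ^ 3 * ‖y - y'‖ ∧
      ‖Ψ g y - Ψ g y' - A (y - y')‖ ≤ C * (|g| + ‖y‖ + ‖y'‖) * ‖y - y'‖
  lipschitz_base : ∀ g g' : ℝ, ∀ y : E, |g| ≤ δ → |g'| ≤ δ → ‖y‖ ≤ δ →
    |φ g y - φ g' y - (g - g') - b * (g ^ 3 - g' ^ 3)| ≤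
        C * (max |g| |g'|) ^ 2 * (max |g| |g'| + ‖y‖) * |g - g'| ∧
      ‖Ψ g y - Ψ g' y‖ ≤ C * (|g| + |g'| + ‖y‖) * |g - g'|
  /-- `C^{1,1}` in the fibre (signature of the lever): differentiability of the step in `y`. -/
  differentiableOn_Ψ : ∀ g : ℝ, |g| ≤ δ → DifferentiableOn ℝ (Ψ g) (Metric.ball 0 δ)
  differentiableOn_φ : ∀ g : ℝ, |g| ≤ δ → DifferentiableOn ℝ (φ g) (Metric.ball 0 δ)
  fderiv_Ψ_sub_le : ∀ g : ℝ, ∀ y : E, |g| ≤ δ → ‖y‖ < δ →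
    ‖fderiv ℝ (Ψ g) y - A‖ ≤ C * (|g| + ‖y‖)
  fderiv_φ_le : ∀ g : ℝ, ∀ y : E, |g| ≤ δ → ‖y‖ < δ → ‖fderiv ℝ (φ g) y‖ ≤ C * |g| ^ 3
  b₀ : ℝ
  b_eq : b = b₀ * Real.log M
  R : ℝ
  δ_le_R : δ ≤ R
  θ' : ℝ
  θ'_nonneg : 0 ≤ θ'
  θ'_lt_one : θ' < 1
  contraction : ∀ g : ℝ, ∀ y y' : E, |g| ≤ δ → ‖y‖ ≤ R → ‖y'‖ ≤ R →
    ‖Ψ g y - Ψ g y'‖ ≤ θ' * ‖y - y'‖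
  remainder_basin : ∀ g : ℝ, ∀ y : E, |g| ≤ δ → ‖y‖ ≤ R →
    |φ g y - (g + b * g ^ 3)| ≤ C * (g ^ 4 + |g| ^ 3 * ‖y‖)
  yW : ℝ → E
  g₀ : ℝ
  g₀_pos : 0 < g₀
  continuousOn_yW : ContinuousOn yW (Set.Icc 0 g₀)
  norm_yW_le : ∀ g ∈ Set.Icc 0 g₀, ‖yW g‖ ≤ R
  betaOf : ℝ → ℝ
  strictAntiOn_betaOf : StrictAntiOn betaOf (Set.Ioc 0 g₀)
  continuousOn_betaOf : ContinuousOn betaOf (Set.Ioc 0 g₀)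
  κ : ℝ
  κ_pos : 0 < κ
  K : ℝ
  betaOf_sub_le : ∀ g ∈ Set.Ioc 0 g₀, |betaOf g - κ / g ^ 2| ≤ K
  /-- Realisation of the pure-curvature strings: `mom p S n f` = smeared, centred, renormalised
  `n`-point function of `tr F²` (unit normalisation) in the effective theory `p` on the torus of
  `S` sites per direction. -/
  mom : ℝ × E → ℕ → (n : ℕ) → (Fin n → 𝓢(EuclideanSpace ℝ (Fin 4), ℝ)) → ℝ
  /-- (4a) for curvature strings: exact RG covariance with block dilation of the test functions. -/
  mom_step : ∀ (g : ℝ) (y : E), g ∈ Set.Icc 0 δ → ‖y‖ ≤ R →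
    ∀ (S n : ℕ) (f : Fin n → 𝓢(EuclideanSpace ℝ (Fin 4), ℝ)),
      mom (φ g y, Ψ g y) S n f = mom (g, y) (M * S) n (fun i => blockDilate M (f i))
  /-- (4b) for curvature strings: identification with Wilson's theory at the Wilson points. -/
  mom_wilson : ∀ g ∈ Set.Ioc 0 g₀,
    ∀ (L n : ℕ) (f : Fin n → 𝓢(EuclideanSpace ℝ (Fin 4), ℝ)),
      mom (g, yW g) (2 * L + 1) n f =
        wilsonCentredSchwinger r.ρ (betaOf g) L (fun _ => 1) n (fun _ => r.curvature) f
  /-- (4c) for curvature strings: continuity on the chart for off-diagonal tuples. -/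
  continuousOn_mom : ∀ (S n : ℕ) (f : Fin n → 𝓢(EuclideanSpace ℝ (Fin 4), ℝ)),
    IsOffDiagonal (SchwartzMap.tensorFin n fun i => ofRealTest (f i)) →
      ContinuousOn (fun p : ℝ × E => mom p S n f) (Set.Icc 0 δ ×ˢ Metric.closedBall 0 R)

namespace CurvatureChart

attribute [instance] instNormedAddCommGroup instNormedSpace instCompleteSpace

end CurvatureChart

/-! ## Stub 1 — the seed: convexity window of one plaquette weight (matrix analysis) -/

/-- Statement of `stub_plaquetteConvexWindow` (verbatim; the head constant shares the stub's name so that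
`BalabanStepParabolic_of` may take it as a hypothesis under the skeleton audit). -/
def Stub.stub_plaquetteConvexWindow : Prop :=
  ∃ C : ℝ, 0 < C ∧ ∀ (N : ℕ) (η : ℝ) (W : Matrix (Fin N) (Fin N) ℂ)
    (Y Z : Fin 4 → Matrix (Fin N) (Fin N) ℂ),
    0 ≤ η → η ≤ 1 → W ∈ Matrix.unitaryGroup (Fin N) ℂ →
    (∀ k, (Y k)ᴴ = -Y k) → (∀ k, (Z k)ᴴ = -Z k) →
    Matrix.PosSemidef (((η ^ 2 : ℝ) : ℂ) • (1 : Matrix (Fin N) (Fin N) ℂ) - (W - 1)ᴴ * (W - 1)) →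
    (∀ k, Matrix.PosSemidef (((η ^ 2 : ℝ) : ℂ) • (1 : Matrix (Fin N) (Fin N) ℂ) - (Y k)ᴴ * Y k)) →
    ((∑ k, Z k)ᴴ * ∑ k, Z k).trace.re - C * η * ∑ k, ((Z k)ᴴ * Z k).trace.re ≤
      iteratedDeriv 2 (fun t : ℝ =>
        -((W * (NormedSpace.exp (Y 0 + (t : ℂ) • Z 0) * NormedSpace.exp (Y 1 + (t : ℂ) • Z 1) *
          NormedSpace.exp (Y 2 + (t : ℂ) • Z 2) * NormedSpace.exp (Y 3 + (t : ℂ) • Z 3))).trace.re)) 0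

/-- **Second-variation bound for a plaquette weight on the small-field window, uniform in `N`.**
For a unitary `W` (holonomy of the background) with `‖W − 1‖_op ≤ η`, anti-Hermitian `Y₀…Y₃`
with `‖Yₖ‖_op ≤ η ≤ 1` (fluctuation point) and anti-Hermitian directions `Z₀…Z₃`, the second
`t`-derivative at `0` of `t ↦ −Re tr(W · ∏ₖ exp(Yₖ + t Zₖ))` is at least the ABELIAN Hessian
`‖∑ₖ Zₖ‖_F²` minus `C η ∑ₖ ‖Zₖ‖_F²`, with an absolute constant `C` (operator-norm windows are
written in the Loewner order, Frobenius norms as `Re tr(ZᴴZ)`). At `W = 1`, `Y = 0` the bound is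
the identity `−Re tr((∑Zₖ)²) − 2Re tr(∑_{k<l}[Zₖ,Z_l])/2 = ‖∑Zₖ‖_F²` (traces of commutators
vanish); the window terms are Hölder estimates `|tr(AZBZ'C)| ≤ ‖A‖‖B‖‖C‖‖Z‖_F‖Z'‖_F` on the
exponential series. Plaquette-level input to uniform log-concavity of the fibre action. -/
theorem stub_plaquetteConvexWindow :
    ∃ C : ℝ, 0 < C ∧ ∀ (N : ℕ) (η : ℝ) (W : Matrix (Fin N) (Fin N) ℂ)
      (Y Z : Fin 4 → Matrix (Fin N) (Fin N) ℂ),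
      0 ≤ η → η ≤ 1 → W ∈ Matrix.unitaryGroup (Fin N) ℂ →
      (∀ k, (Y k)ᴴ = -Y k) → (∀ k, (Z k)ᴴ = -Z k) →
      Matrix.PosSemidef (((η ^ 2 : ℝ) : ℂ) • (1 : Matrix (Fin N) (Fin N) ℂ) - (W - 1)ᴴ * (W - 1)) →
      (∀ k, Matrix.PosSemidef (((η ^ 2 : ℝ) : ℂ) • (1 : Matrix (Fin N) (Fin N) ℂ) - (Y k)ᴴ * Y k)) →
      ((∑ k, Z k)ᴴ * ∑ k, Z k).trace.re - C * η * ∑ k, ((Z k)ᴴ * Z k).trace.re ≤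
        iteratedDeriv 2 (fun t : ℝ =>
          -((W * (NormedSpace.exp (Y 0 + (t : ℂ) • Z 0) * NormedSpace.exp (Y 1 + (t : ℂ) • Z 1) *
            NormedSpace.exp (Y 2 + (t : ℂ) • Z 2) * NormedSpace.exp (Y 3 + (t : ℂ) • Z 3))).trace.re)) 0 := by
  sorry

/-! ## Stub 2 — Bałaban's positivity, abelianised: coercivity of the constrained curl form -/

section Lattice

variable {L : ℕ}

/-- Local coordinate of a torus site inside its `M`-block: `(x μ) mod M` (representative of
`x μ ∈ ZMod L` in `[0, L)` first; blocks are aligned at `0`, `M ∣ L`). -/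
def blockLoc (M : ℕ) (x : Literature.MathematicalPhysics.QuantumFieldTheory.Site 4 L) (μ : Fin 4) : ℕ :=
  (x μ).val % M

/-- Two sites lie in the same `M`-block of the torus of side `L` (`M ∣ L`). -/
def SameBlock (M : ℕ) (x x₀ : Literature.MathematicalPhysics.QuantumFieldTheory.Site 4 L) : Prop :=
  ∀ μ, (x μ).val / M = (x₀ μ).val / M

/-- **Block-axial (tree) gauge.** The edge `(x, μ)` belongs to the axial tree of its block iff it
stays inside the block (`loc_μ x ≤ M − 2`) and all lower-index local coordinates of `x` vanish;
these `M⁴ − 1` edges per block form a spanning tree rooted at the block corner. A 1-form is in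
block-axial gauge iff it vanishes on every tree edge. -/
def IsBlockAxial (M : ℕ) (A : Edge 4 L → ℝ) : Prop :=
  ∀ e : Edge 4 L, blockLoc M e.1 e.2 + 2 ≤ M → (∀ ν, ν < e.2 → blockLoc M e.1 ν = 0) → A e = 0

/-- The abelian lattice curl `(dA)(p) = A(x,i) + A(x+eᵢ,j) − A(x+eⱼ,i) − A(x,j)` of a real
1-form on the torus (the plaquette Hessian of Wilson's action at the trivial background is
`‖dA‖²` tensored with the Lie algebra). -/
def curl (A : Edge 4 L → ℝ) (p : Plaquette 4 L) : ℝ :=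
  A (p.1, p.2.1.1) + A (p.1.shift p.2.1.1, p.2.1.2) - A (p.1.shift p.2.1.2, p.2.1.1) - A (p.1, p.2.1.2)

/-- Straight contour sum of length `M` from `x` in direction `μ`: `∑_{k<M} A(x + k eμ, μ)`. -/
def contourSum (M : ℕ) (A : Edge 4 L → ℝ)
    (x : Literature.MathematicalPhysics.QuantumFieldTheory.Site 4 L) (μ : Fin 4) : ℝ :=
  ∑ k ∈ Finset.range M,
    A ((fun z : Literature.MathematicalPhysics.QuantumFieldTheory.Site 4 L => z.shift μ)^[k] x, μ)

open Classical in
/-- **Vanishing linearised block averages** (Bałaban's averaging constraint at the trivial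
background): for every block `B` and direction `μ`, `∑_{x ∈ B} ∑_{k<M} A(x + k eμ, μ) = 0`. -/
def BlockAvgZero (M : ℕ) [NeZero L] (A : Edge 4 L → ℝ) : Prop :=
  ∀ (x₀ : Literature.MathematicalPhysics.QuantumFieldTheory.Site 4 L) (μ : Fin 4),
    ∑ x ∈ Finset.univ.filter (fun x => SameBlock M x x₀), contourSum M A x μ = 0

end Lattice

/-- Statement of `stub_constrainedAxialGap` (verbatim; quoted by stub 5 and the composition). -/
def Stub.stub_constrainedAxialGap : Prop :=
  ∀ M : ℕ, 2 ≤ M → ∃ c : ℝ, 0 < c ∧ ∀ (L : ℕ) [NeZero L], M ∣ L →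
    ∀ A : Edge 4 L → ℝ, IsBlockAxial M A → BlockAvgZero M A →
      c * ∑ e : Edge 4 L, A e ^ 2 ≤ ∑ p : Plaquette 4 L, curl A p ^ 2

/-- **Coercivity of the constrained curl form, uniformly in the volume** (Bałaban's "lower bound
for the quadratic form" behind CMP 95 and CMP 102 Thm 1, in abelianised, exactly-constrained
form): for `M ≥ 2` there is `c(M) > 0` such that on every torus of side `L`, `M ∣ L`, every real
1-form in block-axial gauge with vanishing linearised block averages satisfies
`c ∑ₑ A(e)² ≤ ∑ₚ (dA)(p)²`. (Kernel: closed ⇒ `A = dλ + h`; axial ⇒ `λ = c_B − h·loc` blockwise,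
so `A` vanishes inside blocks and equals `c_{B+eμ} − c_B + M hμ` on crossing edges; the
constraint kills these. Uniformity in `L` by locality of both sides.) -/
theorem stub_constrainedAxialGap :
    ∀ M : ℕ, 2 ≤ M → ∃ c : ℝ, 0 < c ∧ ∀ (L : ℕ) [NeZero L], M ∣ L →
      ∀ A : Edge 4 L → ℝ, IsBlockAxial M A → BlockAvgZero M A →
        c * ∑ e : Edge 4 L, A e ^ 2 ≤ ∑ p : Plaquette 4 L, curl A p ^ 2 := by
  sorry

/-! ## Stub 3 — the mechanism: no derivative loss for log-concave fibre free energies -/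

/-- Statement of `stub_noDerivativeLoss` (verbatim; quoted by stub 5 and the composition). -/
def Stub.stub_noDerivativeLoss : Prop :=
  ∀ (m : ℕ) (P : Type) [NormedAddCommGroup P] [NormedSpace ℝ P] (U : Set P)
    (S : P → EuclideanSpace ℝ (Fin m) → ℝ) (κ L₁ L₂ L₃ : ℝ),
    IsOpen U → Convex ℝ U → 0 < κ → 0 ≤ L₁ → 0 ≤ L₂ → 0 ≤ L₃ →
    ContDiffOn ℝ 2 (fun q : P × EuclideanSpace ℝ (Fin m) => S q.1 q.2) (U ×ˢ Set.univ) →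
    (∀ p ∈ U, ∀ x v : EuclideanSpace ℝ (Fin m),
      κ * ‖v‖ ^ 2 ≤ iteratedFDeriv ℝ 2 (S p) x ![v, v]) →
    (∀ p ∈ U, ∀ x, ‖fderiv ℝ (fun q => S q x) p‖ ≤ L₁) →
    (∀ p ∈ U, ∀ x x', ‖fderiv ℝ (fun q => S q x) p - fderiv ℝ (fun q => S q x') p‖ ≤
      L₂ * ‖x - x'‖) →
    (∀ p ∈ U, ∀ p' ∈ U, ∀ x, ‖fderiv ℝ (fun q => S q x) p - fderiv ℝ (fun q => S q x) p'‖ ≤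
      L₃ * ‖p - p'‖) →
    DifferentiableOn ℝ (fun p => -Real.log (∫ x, Real.exp (-S p x))) U ∧
    (∀ p ∈ U, ‖fderiv ℝ (fun p => -Real.log (∫ x, Real.exp (-S p x))) p‖ ≤ L₁) ∧
    (∀ p ∈ U, ∀ p' ∈ U,
      ‖fderiv ℝ (fun p => -Real.log (∫ x, Real.exp (-S p x))) p -
          fderiv ℝ (fun p => -Real.log (∫ x, Real.exp (-S p x))) p'‖ ≤
        (L₃ + L₂ ^ 2 / κ) * ‖p - p'‖)

/-- **Dimension-free `C^{1,1}` regularity of a log-concave fibre free energy in a Banach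
parameter** (Brascamp–Lieb mechanism). Let `P` be a real normed space (parameters: coupling,
previous action, block field), `U ⊆ P` open convex, and `S : P × ℝᵐ → ℝ` jointly `C²` on
`U × ℝᵐ` with `D²ₓS(p,x)(v,v) ≥ κ‖v‖²` (uniform convexity in the fibre variable) and the bounds
`‖∂ₚS‖ ≤ L₁`, `Lip_x(∂ₚS) ≤ L₂`, `Lip_p(∂ₚS) ≤ L₃`. Then `W(p) = −log ∫ e^{−S(p,x)} dx` is
differentiable on `U` with `‖DW‖ ≤ L₁` and `Lip(DW) ≤ L₃ + L₂²/κ` — constants INDEPENDENT of `m`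
(`DW = ⟨∂ₚS⟩`; the `p`-variation of the Gibbs average is a covariance, bounded by Cauchy–Schwarz
and the Brascamp–Lieb/Bakry–Émery variance bound `Var ≤ κ⁻¹⟨|∇ₓ·|²⟩`; tree facts
`BrascampLieb1976_thm41_holds`, `BakryEmery_poincare_of_uniformlyConvex_holds`). -/
theorem stub_noDerivativeLoss :
    ∀ (m : ℕ) (P : Type) [NormedAddCommGroup P] [NormedSpace ℝ P] (U : Set P)
      (S : P → EuclideanSpace ℝ (Fin m) → ℝ) (κ L₁ L₂ L₃ : ℝ),
      IsOpen U → Convex ℝ U → 0 < κ → 0 ≤ L₁ → 0 ≤ L₂ → 0 ≤ L₃ →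
      ContDiffOn ℝ 2 (fun q : P × EuclideanSpace ℝ (Fin m) => S q.1 q.2) (U ×ˢ Set.univ) →
      (∀ p ∈ U, ∀ x v : EuclideanSpace ℝ (Fin m),
        κ * ‖v‖ ^ 2 ≤ iteratedFDeriv ℝ 2 (S p) x ![v, v]) →
      (∀ p ∈ U, ∀ x, ‖fderiv ℝ (fun q => S q x) p‖ ≤ L₁) →
      (∀ p ∈ U, ∀ x x', ‖fderiv ℝ (fun q => S q x) p - fderiv ℝ (fun q => S q x') p‖ ≤
        L₂ * ‖x - x'‖) →
      (∀ p ∈ U, ∀ p' ∈ U, ∀ x, ‖fderiv ℝ (fun q => S q x) p - fderiv ℝ (fun q => S q x) p'‖ ≤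
        L₃ * ‖p - p'‖) →
      DifferentiableOn ℝ (fun p => -Real.log (∫ x, Real.exp (-S p x))) U ∧
      (∀ p ∈ U, ‖fderiv ℝ (fun p => -Real.log (∫ x, Real.exp (-S p x))) p‖ ≤ L₁) ∧
      (∀ p ∈ U, ∀ p' ∈ U,
        ‖fderiv ℝ (fun p => -Real.log (∫ x, Real.exp (-S p x))) p -
            fderiv ℝ (fun p => -Real.log (∫ x, Real.exp (-S p x))) p'‖ ≤
          (L₃ + L₂ ^ 2 / κ) * ‖p - p'‖) := by
  sorry

/-! ## Stub 4 — quasi-locality: covariance decay for finite-range uniformly convex weights -/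

/-- Statement of `stub_convexCovarianceDecay` (verbatim; quoted by stub 5 and the composition). -/
def Stub.stub_convexCovarianceDecay : Prop :=
  ∀ (κ Λ R₀ : ℝ) (D : ℕ), 0 < κ → 0 ≤ Λ → 0 ≤ R₀ → ∃ C c : ℝ, 0 < C ∧ 0 < c ∧
    ∀ (m : ℕ) (ρ : Fin m → Fin m → ℝ) (Φ : EuclideanSpace ℝ (Fin m) → ℝ),
      (∀ i, ρ i i = 0) → (∀ i j, ρ i j = ρ j i) → (∀ i j k, ρ i k ≤ ρ i j + ρ j k) →
      (∀ i, (Finset.univ.filter fun j => ρ i j ≤ R₀).card ≤ D) →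
      ContDiff ℝ 2 Φ →
      (∀ x v : EuclideanSpace ℝ (Fin m), κ * ‖v‖ ^ 2 ≤ iteratedFDeriv ℝ 2 Φ x ![v, v]) →
      (∀ x i j, |iteratedFDeriv ℝ 2 Φ x
        ![EuclideanSpace.single i (1 : ℝ), EuclideanSpace.single j (1 : ℝ)]| ≤ Λ) →
      (∀ x i j, R₀ < ρ i j → iteratedFDeriv ℝ 2 Φ x
        ![EuclideanSpace.single i (1 : ℝ), EuclideanSpace.single j (1 : ℝ)] = 0) →
      ∀ (u v : EuclideanSpace ℝ (Fin m) → ℝ) (I J : Finset (Fin m)) (Bu Bv d : ℝ),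
        ContDiff ℝ 1 u → ContDiff ℝ 1 v →
        (∃ B, ∀ x, |u x| ≤ B ∧ |v x| ≤ B) →
        (∀ x, ‖gradient u x‖ ≤ Bu) → (∀ x, ‖gradient v x‖ ≤ Bv) →
        (∀ x, ∀ i ∉ I, inner ℝ (gradient u x) (EuclideanSpace.single i (1 : ℝ)) = 0) →
        (∀ x, ∀ j ∉ J, inner ℝ (gradient v x) (EuclideanSpace.single j (1 : ℝ)) = 0) →
        (∀ i ∈ I, ∀ j ∈ J, d ≤ ρ i j) →
        |(∫ x, Real.exp (-Φ x)) * (∫ x, u x * v x * Real.exp (-Φ x)) -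
            (∫ x, u x * Real.exp (-Φ x)) * (∫ x, v x * Real.exp (-Φ x))| ≤
          C * Bu * Bv * Real.exp (-(c * d)) * (∫ x, Real.exp (-Φ x)) ^ 2

/-- **Exponential decay of covariances, dimension-free** (Helffer–Sjöstrand representation +
Combes–Thomas; Helffer, "Remarks on decay of correlations and Witten Laplacians", J. Funct.
Anal. 1998/99; Helffer–Sjöstrand, J. Stat. Phys. 74 (1994)). Coordinates `Fin m` carry a
pseudometric `ρ`; `Φ ∈ C²(ℝᵐ)` with `D²Φ(x)(v,v) ≥ κ‖v‖²`, Hessian entries bounded by `Λ`, of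
range `≤ R₀` (`∂ᵢ∂ⱼΦ ≡ 0` if `ρ i j > R₀`) and `ρ`-balls of radius `R₀` of cardinality `≤ D`.
Then for `C¹` bounded `u, v` with bounded gradients supported (as index sets) in `I`, `J`:
`|Cov_μ(u,v)| ≤ C ‖∇u‖_∞ ‖∇v‖_∞ exp(−c·ρ(I,J))`, `μ ∝ e^{−Φ}dx`, with `C, c > 0` depending only
on `(κ, Λ, R₀, D)` — NOT on `m`; written unnormalised (multiplied through by `Z²`) like the
tree's Bakry–Émery fact. KNOWN theorem (vendorable as a Literature fact); it keeps the effective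
action quasi-local in one weighted norm (the Witten Laplacian on 1-forms is `≥ Hess Φ ≥ κ` and
its index-off-diagonal part is only `Hess`, so Combes–Thomas weights `e^{a ρ(i₀,·)}` cost
`Λ D (e^{a R₀} − 1) < κ`). -/
theorem stub_convexCovarianceDecay :
    ∀ (κ Λ R₀ : ℝ) (D : ℕ), 0 < κ → 0 ≤ Λ → 0 ≤ R₀ → ∃ C c : ℝ, 0 < C ∧ 0 < c ∧
      ∀ (m : ℕ) (ρ : Fin m → Fin m → ℝ) (Φ : EuclideanSpace ℝ (Fin m) → ℝ),
        (∀ i, ρ i i = 0) → (∀ i j, ρ i j = ρ j i) → (∀ i j k, ρ i k ≤ ρ i j + ρ j k) →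
        (∀ i, (Finset.univ.filter fun j => ρ i j ≤ R₀).card ≤ D) →
        ContDiff ℝ 2 Φ →
        (∀ x v : EuclideanSpace ℝ (Fin m), κ * ‖v‖ ^ 2 ≤ iteratedFDeriv ℝ 2 Φ x ![v, v]) →
        (∀ x i j, |iteratedFDeriv ℝ 2 Φ x
          ![EuclideanSpace.single i (1 : ℝ), EuclideanSpace.single j (1 : ℝ)]| ≤ Λ) →
        (∀ x i j, R₀ < ρ i j → iteratedFDeriv ℝ 2 Φ x
          ![EuclideanSpace.single i (1 : ℝ), EuclideanSpace.single j (1 : ℝ)] = 0) →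
        ∀ (u v : EuclideanSpace ℝ (Fin m) → ℝ) (I J : Finset (Fin m)) (Bu Bv d : ℝ),
          ContDiff ℝ 1 u → ContDiff ℝ 1 v →
          (∃ B, ∀ x, |u x| ≤ B ∧ |v x| ≤ B) →
          (∀ x, ‖gradient u x‖ ≤ Bu) → (∀ x, ‖gradient v x‖ ≤ Bv) →
          (∀ x, ∀ i ∉ I, inner ℝ (gradient u x) (EuclideanSpace.single i (1 : ℝ)) = 0) →
          (∀ x, ∀ j ∉ J, inner ℝ (gradient v x) (EuclideanSpace.single j (1 : ℝ)) = 0) →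
          (∀ i ∈ I, ∀ j ∈ J, d ≤ ρ i j) →
          |(∫ x, Real.exp (-Φ x)) * (∫ x, u x * v x * Real.exp (-Φ x)) -
              (∫ x, u x * Real.exp (-Φ x)) * (∫ x, v x * Real.exp (-Φ x))| ≤
            C * Bu * Bv * Real.exp (-(c * d)) * (∫ x, Real.exp (-Φ x)) ^ 2 := by
  sorry

/-! ## Stub 5 — HARDEST: the convex-fibre one-chart presentation of Bałaban's complete step -/

/-- **The convex-fibre chart** (open; carries the crux's content). GIVEN the four inputs above
(plaquette window, constrained gap, no-loss regularity, covariance decay), for every compact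
simple `G`, faithful unitary `r` and all block factors `M ≥ M₀(G, r)` there is a
`CurvatureChart G r M`: Bałaban's complete renormalisation transformation — block-axial gauge,
averaging constraint, fluctuation integral over the CONVEX small-field window in exponential
coordinates (uniformly log-concave by inputs 1+2, hence a `C^{1,1}` quasi-local self-map of ONE
weighted Banach space of effective actions by inputs 3+4: volume-indexed families with the sup of
quasi-local norms, the step acting componentwise so that exact covariance is Fubini on each torus),
PLUS Bałaban's `R`-operation for the window's complement as printed (weight `e^{−p(g)²/2} =
O(g^∞)`, thresholds frozen on overlapping `g`-ranges so that no cut-off moves with `g`), written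
in coordinates `(g, y)` = (marginal coupling, irrelevant remainder) with the parabolic normal form
`φ = g + b₀ log M · g³ + …`, `b₀ > 0` by non-abelianness, the Wilson actions `g ↦ (g, yW g)` in the
basin (at `g = 0` the rescaled Gaussian slice, Bałaban CMP 95/96), and the pure-curvature `n`-point
functions realised along the flow by the source-carrying version of the same step (local coupling
modulation; composite-operator flow of `tr F²`), continuous on the chart for off-diagonal tuples.
Uses `stub_plaquetteConvexWindow`/`stub_constrainedAxialGap` for the fibre modulus `β(c_M − Cη) > 0` on the
window `η = g·p(g)`, `stub_noDerivativeLoss` for `remainder`, `lipschitz_fibre`, `lipschitz_base`,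
`fderiv_*`, and `stub_convexCovarianceDecay` for the norm of `E`. Why it might fail: the `R`-part
(large-field histories are a sum, not one quasi-local `y`, CMP 119 (2.18)–(2.22)); convexity
modulus vs. fibre curvature `O(1) − O(g²)·curv`; `M₀` large. -/
theorem stub_convexFibreChart :
    Stub.stub_plaquetteConvexWindow → Stub.stub_constrainedAxialGap → Stub.stub_noDerivativeLoss →
    Stub.stub_convexCovarianceDecay →
    ∀ (G : Type) [Group G] [TopologicalSpace G] [IsTopologicalGroup G] [CompactSpace G],
      IsCompactSimpleLieGroup G →
      letI : MeasurableSpace G := borel G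
      haveI : BorelSpace G := ⟨rfl⟩
      ∀ (r : LatticeRep G), ∃ M₀ : ℕ, ∀ M : ℕ, M₀ ≤ M → Nonempty (CurvatureChart G r M) := by
  sorry

/-- Statement of `stub_convexFibreChart` (verbatim; quoted by the composition). -/
def Stub.stub_convexFibreChart : Prop :=
  Stub.stub_plaquetteConvexWindow → Stub.stub_constrainedAxialGap → Stub.stub_noDerivativeLoss →
  Stub.stub_convexCovarianceDecay →
  ∀ (G : Type) [Group G] [TopologicalSpace G] [IsTopologicalGroup G] [CompactSpace G],
    IsCompactSimpleLieGroup G →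
    letI : MeasurableSpace G := borel G
    haveI : BorelSpace G := ⟨rfl⟩
    ∀ (r : LatticeRep G), ∃ M₀ : ℕ, ∀ M : ℕ, M₀ ≤ M → Nonempty (CurvatureChart G r M)

/-! ## Species reduction (proved), negative-side corollaries, and the composition -/

section Reduction

variable {G : Type} [Group G] [TopologicalSpace G] [IsTopologicalGroup G] [CompactSpace G]
  [MeasurableSpace G] [BorelSpace G] {r : LatticeRep G} {M : ℕ}

/-- A species string with a zero-normalised entry has vanishing centred Wilson `n`-point function:
the smeared field with multiplicative normalisation `0` is identically `0`. [folklore] -/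
theorem wilsonCentredSchwinger_eq_zero_of_norm_zero {N : ℕ} (ρ : G →* Matrix (Fin N) (Fin N) ℂ)
    (β : ℝ) (L : ℕ) (c : YMSpecies G → ℝ) {n : ℕ} (σ : Fin n → YMSpecies G)
    (f : Fin n → 𝓢(EuclideanSpace ℝ (Fin 4), ℝ)) {i : Fin n} (hi : c (σ i) = 0) :
    wilsonCentredSchwinger ρ β L c n σ f = 0 := by
  unfold wilsonCentredSchwinger
  have h : ∀ U : LGConfig 4 G, (∏ j, smearedLatticeField (σ j).F
      (Literature.Probability.LatticeModels.box 4 L) 1 (c (σ j))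
      (wilsonTorusMean ρ β L (σ j).F) (f j) U) = 0 := fun U =>
    Finset.prod_eq_zero (Finset.mem_univ i) (by simp [smearedLatticeField, hi])
  simp [h]

open Classical in
/-- **Species reduction (the step of a curvature chart).** A `CurvatureChart` yields a
`BalabanBanachStep` with the same chart, step, basin, Wilson embedding and `betaOf`, with
normalisations `c g s = 𝟙[s = r.curvature]` and `expect` = `mom` on pure-curvature strings, `0`
otherwise ((4b) for a string with a non-curvature entry: both sides vanish,
`wilsonCentredSchwinger_eq_zero_of_norm_zero`). The `C^{1,1}` fields are not needed for this. -/
def CurvatureChart.toStep (X : CurvatureChart G r M) : BalabanBanachStep G r M where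
  E := X.E
  φ := X.φ
  Ψ := X.Ψ
  A := X.A
  b := X.b
  θ := X.θ
  C := X.C
  δ := X.δ
  b_pos := X.b_pos
  θ_nonneg := X.θ_nonneg
  θ_lt_one := X.θ_lt_one
  C_pos := X.C_pos
  δ_pos := X.δ_pos
  norm_A_le := X.norm_A_le
  remainder := X.remainder
  lipschitz_fibre := X.lipschitz_fibre
  lipschitz_base := X.lipschitz_base
  b₀ := X.b₀
  b_eq := X.b_eq
  R := X.R
  δ_le_R := X.δ_le_R
  θ' := X.θ'
  θ'_nonneg := X.θ'_nonneg
  θ'_lt_one := X.θ'_lt_one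
  contraction := X.contraction
  remainder_basin := X.remainder_basin
  yW := X.yW
  g₀ := X.g₀
  g₀_pos := X.g₀_pos
  continuousOn_yW := X.continuousOn_yW
  norm_yW_le := X.norm_yW_le
  betaOf := X.betaOf
  strictAntiOn_betaOf := X.strictAntiOn_betaOf
  continuousOn_betaOf := X.continuousOn_betaOf
  κ := X.κ
  κ_pos := X.κ_pos
  K := X.K
  betaOf_sub_le := X.betaOf_sub_le
  c := fun _ s => if s = r.curvature then 1 else 0
  c_curvature := fun g => by simp
  expect := fun p S n σ f => if (∀ i, σ i = r.curvature) then X.mom p S n f else 0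
  expect_step := by
    intro g y hg hy S n σ f
    by_cases h : ∀ i, σ i = r.curvature
    · rw [if_pos h, if_pos h]
      exact X.mom_step g y hg hy S n f
    · rw [if_neg h, if_neg h]
  expect_wilson := by
    intro g hg L n σ f
    by_cases h : ∀ i, σ i = r.curvature
    · rw [if_pos h]
      have hσ : σ = fun _ => r.curvature := funext h
      subst hσ
      rw [X.mom_wilson g hg L n f]
      simp [wilsonCentredSchwinger]
    · rw [if_neg h]
      push Not at h
      obtain ⟨i, hi⟩ := h
      exact (wilsonCentredSchwinger_eq_zero_of_norm_zero r.ρ (X.betaOf g) L _ σ f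
        (i := i) (by simp [hi])).symm
  continuousOn_expect := by
    intro S n σ f hf
    by_cases h : ∀ i, σ i = r.curvature
    · simp only [if_pos h]
      exact X.continuousOn_mom S n f hf
    · simp only [if_neg h]
      exact continuousOn_const

/-- **Species reduction**: a `CurvatureChart` inhabits `BalabanBanachStep`. -/
theorem nonempty_balabanBanachStep (X : CurvatureChart G r M) :
    Nonempty (BalabanBanachStep G r M) :=
  ⟨X.toStep⟩

namespace CurvatureChart

variable (X : CurvatureChart G r M)

/-- The step of `X.toStep` is `X`'s step (`rfl`). -/
@[simp] theorem toStep_F_apply (g : ℝ) (y : X.E) : X.toStep.F (g, y) = (X.φ g y, X.Ψ g y) := rfl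

/-- The Wilson embedding of `X.toStep` is `X`'s (`rfl`). -/
@[simp] theorem toStep_yW : X.toStep.yW = X.yW := rfl

/-- The bare inverse coupling of `X.toStep` is `X`'s (`rfl`). -/
@[simp] theorem toStep_betaOf : X.toStep.betaOf = X.betaOf := rfl

open Classical in
/-- Unfolding the realisation functional of `X.toStep` (`rfl`). -/
theorem toStep_expect (p : ℝ × X.E) (S n : ℕ) (σ : Fin n → YMSpecies G)
    (f : Fin n → 𝓢(EuclideanSpace ℝ (Fin 4), ℝ)) :
    X.toStep.expect p S n σ f = if (∀ i, σ i = r.curvature) then X.mom p S n f else 0 := rfl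

/-- On pure-curvature strings the realisation functional of `X.toStep` is `mom`. -/
@[simp] theorem toStep_expect_curvature (p : ℝ × X.E) (S n : ℕ)
    (f : Fin n → 𝓢(EuclideanSpace ℝ (Fin 4), ℝ)) :
    X.toStep.expect p S n (fun _ => r.curvature) f = X.mom p S n f := by
  rw [toStep_expect, if_pos (fun _ => rfl)]

/-- **What (4a)+(4b) pin along Wilson orbits** (from the landed `Negative.expect_orbit_wilson`,
applied to `X.toStep`; `X.toStep.yW = X.yW`, `X.toStep.F (g, y) = (X.φ g y, X.Ψ g y)` by `rfl`):
at depth `k` of the orbit of the Wilson point `(g, yW g)` (in the chart for `k` steps), `mom` on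
the odd torus `2L+1` IS the genuine centred plaquette `n`-point function at `β = betaOf g` on the
torus `2L'+1 = M^k(2L+1)` with `k`-fold block-dilated test functions (such `L'` exists for all `k`
iff `M` is odd, `Negative.pow_mul_odd_eq`). The stub-5 prover has no freedom there. [folklore] -/
theorem mom_orbit_wilson {g : ℝ} (hg : g ∈ Set.Ioc 0 X.g₀) (k : ℕ)
    (hk : ∀ i < k, (X.toStep.F^[i] (g, X.toStep.yW g)).1 ∈ Set.Icc 0 X.δ ∧
      ‖(X.toStep.F^[i] (g, X.toStep.yW g)).2‖ ≤ X.R)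
    (L L' n : ℕ) (hL : M ^ k * (2 * L + 1) = 2 * L' + 1)
    (f : Fin n → 𝓢(EuclideanSpace ℝ (Fin 4), ℝ)) :
    X.mom (X.toStep.F^[k] (g, X.toStep.yW g)) (2 * L + 1) n f =
      wilsonCentredSchwinger r.ρ (X.betaOf g) L' (fun _ => 1) n (fun _ => r.curvature)
        (fun i => (blockDilate M)^[k] (f i)) := by
  have h := Negative.expect_orbit_wilson X.toStep hg k hk L L' n hL (fun _ => r.curvature) f
  rw [toStep_expect_curvature] at h
  exact h.trans (Negative.wilsonCentredSchwinger_congr_c r.ρ _ L'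
    (fun _ => X.toStep.c_curvature g) _)

/-- **What (4c) costs at odd `M`** (from the landed `Negative.tendsto_wilson_of_tendsto_orbit`,
applied to `X.toStep`): if a sequence of in-chart orbit points of Wilson points converges IN THE
CHART to `q`, the genuine dilated Wilson plaquette `n`-point functions along it (off-diagonal
tuples) converge to `mom q` — with `k_j → ∞`, `g_j → 0⁺` a joint continuum/thermodynamic limit
along the chart's own tuning `β_j = betaOf g_j`. This is the open content of
`stub_convexFibreChart` (its field `continuousOn_mom`). [folklore] -/
theorem tendsto_wilson_of_tendsto_orbit (hM : Odd M) {g : ℕ → ℝ} {k : ℕ → ℕ}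
    (hg : ∀ j, g j ∈ Set.Ioc 0 X.g₀)
    (hk : ∀ j, ∀ i ≤ k j, (X.toStep.F^[i] (g j, X.toStep.yW (g j))).1 ∈ Set.Icc 0 X.δ ∧
      ‖(X.toStep.F^[i] (g j, X.toStep.yW (g j))).2‖ ≤ X.R)
    {q : ℝ × X.E} (hq : q ∈ Set.Icc 0 X.δ ×ˢ Metric.closedBall (0 : X.E) X.R)
    (hconv : Tendsto (fun j => X.toStep.F^[k j] (g j, X.toStep.yW (g j))) atTop (𝓝 q))
    (L n : ℕ) (f : Fin n → 𝓢(EuclideanSpace ℝ (Fin 4), ℝ))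
    (hf : IsOffDiagonal (SchwartzMap.tensorFin n fun i => ofRealTest (f i))) :
    Tendsto (fun j => wilsonCentredSchwinger r.ρ (X.betaOf (g j))
        ((M ^ (k j) * (2 * L + 1) - 1) / 2) (fun _ => 1) n (fun _ => r.curvature)
        (fun i => (blockDilate M)^[k j] (f i))) atTop (𝓝 (X.mom q (2 * L + 1) n f)) := by
  have h := Negative.tendsto_wilson_of_tendsto_orbit X.toStep hM hg hk hq hconv L n
    (fun _ => r.curvature) f hf
  rw [toStep_expect_curvature] at h
  refine h.congr fun j => ?_
  exact Negative.wilsonCentredSchwinger_congr_c r.ρ _ _ (fun _ => X.toStep.c_curvature (g j)) _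

/-- **`b₀` is not pinned by the output type** (from the landed `Negative.exists_b₀_eq`, applied to
`X.toStep`): once a `CurvatureChart` exists, `BalabanBanachStep G r M` is inhabited with ANY
positive value of the field `b₀`, with the same slope `κ b₀`. The line claims the physical
one-loop slope only for its intended inhabitant, never in the type. [folklore] -/
theorem b₀_unpinned (t : ℝ) (ht : 0 < t) :
    ∃ S' : BalabanBanachStep G r M, S'.b₀ = t ∧ S'.κ * S'.b₀ = X.κ * X.b₀ := by
  obtain ⟨S', h1, h2, -⟩ := Negative.exists_b₀_eq X.toStep t ht
  exact ⟨S', h1, h2⟩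

end CurvatureChart

end Reduction

/-- **Composition.** The five stubs imply the crux BY NAME: feed stubs 1–4 to stub 5, take `M₀`
from it, and reduce species (`nonempty_balabanBanachStep`). Hypotheses are the stub statements by
name (`Stub.stub_*`, definitionally the registered stub goals); real proof, no sorry. -/
theorem BalabanStepParabolic_of :
    Stub.stub_plaquetteConvexWindow → Stub.stub_constrainedAxialGap → Stub.stub_noDerivativeLoss →
    Stub.stub_convexCovarianceDecay → Stub.stub_convexFibreChart →
    Summit.QuantumFields.YangMills.Theses.ParabolicTrajectory.BalabanStepParabolic := by
  intro h1 h2 h3 h4 h5 G _ _ _ _ hG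
  letI : MeasurableSpace G := borel G
  haveI : BorelSpace G := ⟨rfl⟩
  intro r
  obtain ⟨M₀, hM₀⟩ := h5 h1 h2 h3 h4 G hG r
  exact ⟨M₀, fun M hM => (hM₀ M hM).elim fun X => nonempty_balabanBanachStep X⟩

/-- The crux by name, from the registered (sorried) stubs fed to the composition: `sorry` enters
only through `stub_*`; each stub's inline goal is definitionally its `Stub.stub_*` statement. -/
theorem BalabanStepParabolic_closed :
    Summit.QuantumFields.YangMills.Theses.ParabolicTrajectory.BalabanStepParabolic :=
  BalabanStepParabolic_of stub_plaquetteConvexWindow stub_constrainedAxialGap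
    stub_noDerivativeLoss stub_convexCovarianceDecay stub_convexFibreChart


/-! ## Certificate (second line lead `prover-line-stmt-QuantumFields-9684-b-0`, 2026-08-16):
## `CurvatureChart` is inhabited iff `BalabanBanachStep` is — the load-bearing stub is the crux

Kernel-checked audit of `stub_convexFibreChart` against the standing negative results (all LANDED under
`Theorems/BalabanStepParabolic/Negative/`), appended by the second lead without touching the planner's
skeleton above:
* `thinChart`: the disprover's thin polynomial maps (`φ = g + b g³`, `Ψ = y/2` on any real Banach fibre)
  satisfy the `C^{1,1}` fields of `CurvatureChart` trivially (`fderiv Ψ = A`, `fderiv φ = 0`), so every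
  junk inhabitant of `BalabanBanachStep` is a junk inhabitant of `CurvatureChart`:
  `nonempty_curvatureChart_of_even` (from `Negative.expectE`, every even `M ≥ 2`) and
  `nonempty_curvatureChart_of_uniformOverTuned` (from `Negative.expectC`, odd `M ≥ 2`, under uniform
  over-tuned triviality at some slope `B > 0`).
* `nonempty_curvatureChart_iff` : `Nonempty (CurvatureChart G r M) ↔ Nonempty (BalabanBanachStep G r M)`
  for EVERY `M`, every compact `G`, every `r` (⇒ `toStep`; ⇐ parity split + drefute's
  `Negative.uniformOverTuned_of_nonempty`).
* `convexFibreChart_conclusion_iff_crux` : the conclusion of `stub_convexFibreChart` ↔ `BalabanStepParabolic`;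
  hence, GIVEN its four input stubs (true by the planner's gen-2 audit), stub 5 is a COSTUME of the crux,
  and `convexFibreChart_conclusion_false_of_faceContactHypothesis` /
  `stub_convexFibreChart_false_of_inputs` : under cdisprove gen 4's `FaceContactHypothesis` the conclusion
  is FALSE and so is stub 5 once stubs 1–4 hold (periodic face contact is admitted by the verbatim field
  `continuousOn_mom`).
-/

section Certificate

open Summit.QuantumFields.YangMills.Theorems.BalabanStepParabolic.Negative

variable {G : Type} [Group G] [TopologicalSpace G] [IsTopologicalGroup G] [CompactSpace G]
  [MeasurableSpace G] [BorelSpace G] (r : LatticeRep G) (M : ℕ)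

/-- `‖(1/2) • id‖ ≤ 1/2` on any real normed space. [folklore] -/
theorem norm_half_smul_id_le (F : Type) [NormedAddCommGroup F] [NormedSpace ℝ F] :
    ‖(1 / 2 : ℝ) • ContinuousLinearMap.id ℝ F‖ ≤ 1 / 2 := by
  refine (norm_smul_le (1 / 2 : ℝ) (ContinuousLinearMap.id ℝ F)).trans ?_
  have h : ‖ContinuousLinearMap.id ℝ F‖ ≤ 1 := ContinuousLinearMap.norm_id_le
  have : ‖(1 / 2 : ℝ)‖ = 1 / 2 := by norm_num
  rw [this]
  linarith [norm_nonneg (ContinuousLinearMap.id ℝ F)]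

/-- `((1/2) • id) y = (1/2) • y` on any real normed space. [folklore] -/
theorem half_smul_id_apply (F : Type) [NormedAddCommGroup F] [NormedSpace ℝ F] (y : F) :
    ((1 / 2 : ℝ) • ContinuousLinearMap.id ℝ F) y = (1 / 2 : ℝ) • y := rfl

/-- **The thin curvature chart.** On ANY real Banach fibre `F`, the junk maps `φ g y = g + b g³`,
`Ψ g y = y/2` (`A = ½·id`, `C = 1`, `δ = 1`, `R = 2`, `θ = θ' = ½`), a continuous Wilson embedding
`yWc : [0, 1] → B̄₂`, `betaOf g = κ/g²`, and a curvature functional `X` satisfying the three realisation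
axioms for the junk step, form a `CurvatureChart G r M` — the `C^{1,1}` fields hold with room to spare
(`fderiv (Ψ g) = A`, `fderiv (φ g) = 0`).  The whole content of the line's object therefore sits in
(4c) for `X`, exactly as for `BalabanBanachStep` (`Negative.nonempty_of_thinChartFunctional`). [folklore] -/
def thinChart (F : Type) [NormedAddCommGroup F] [NormedSpace ℝ F] [CompleteSpace F]
    {b κ : ℝ} (hb : 0 < b) (hκ : 0 < κ) (hlog : 0 < Real.log M)
    (yWc : ℝ → F) (hyWc : Continuous yWc) (hyWn : ∀ g ∈ Set.Icc (0 : ℝ) 1, ‖yWc g‖ ≤ 2)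
    (X : ℝ × F → ℕ → (n : ℕ) → (Fin n → 𝓢(EuclideanSpace ℝ (Fin 4), ℝ)) → ℝ)
    (h4a : ∀ (p : ℝ × F) (S n : ℕ) (f : Fin n → 𝓢(EuclideanSpace ℝ (Fin 4), ℝ)),
      X (p.1 + b * p.1 ^ 3, (1 / 2 : ℝ) • p.2) S n f = X p (M * S) n (fun i => blockDilate M (f i)))
    (h4b : ∀ g ∈ Set.Ioc (0 : ℝ) 1, ∀ (L n : ℕ) (f : Fin n → 𝓢(EuclideanSpace ℝ (Fin 4), ℝ)),
      X (g, yWc g) (2 * L + 1) n f =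
        wilsonCentredSchwinger r.ρ (κ / g ^ 2) L (fun _ => 1) n (fun _ => r.curvature) f)
    (h4c : ∀ (S n : ℕ) (f : Fin n → 𝓢(EuclideanSpace ℝ (Fin 4), ℝ)),
      IsOffDiagonal (SchwartzMap.tensorFin n fun i => ofRealTest (f i)) →
        Continuous fun p : ℝ × F => X p S n f) :
    CurvatureChart G r M where
  E := F
  φ := fun g _ => g + b * g ^ 3
  Ψ := fun _ y => (1 / 2 : ℝ) • y
  A := (1 / 2 : ℝ) • ContinuousLinearMap.id ℝ F
  b := b
  θ := 1 / 2
  C := 1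
  δ := 1
  b_pos := hb
  θ_nonneg := by norm_num
  θ_lt_one := by norm_num
  C_pos := one_pos
  δ_pos := one_pos
  norm_A_le := norm_half_smul_id_le F
  remainder := fun g y _ _ => by
    constructor
    · simp only [sub_self, abs_zero]; positivity
    · rw [half_smul_id_apply, sub_self, norm_zero]
      positivity
  lipschitz_fibre := fun g y y' _ _ _ => by
    constructor
    · simp only [sub_self, abs_zero]; positivity
    · have : (1 / 2 : ℝ) • y - (1 / 2 : ℝ) • y' -
          ((1 / 2 : ℝ) • ContinuousLinearMap.id ℝ F) (y - y') = 0 := by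
        rw [half_smul_id_apply, smul_sub]
        abel
      rw [this, norm_zero]; positivity
  lipschitz_base := fun g g' y _ _ _ => by
    constructor
    · have : g + b * g ^ 3 - (g' + b * g' ^ 3) - (g - g') - b * (g ^ 3 - g' ^ 3) = 0 := by ring
      rw [this, abs_zero]; positivity
    · simp only [sub_self, norm_zero]; positivity
  differentiableOn_Ψ := fun g _ => differentiableOn_id.const_smul (1 / 2 : ℝ)
  differentiableOn_φ := fun g _ => differentiableOn_const _
  fderiv_Ψ_sub_le := fun g y _ _ => by
    have hΨ : (fun y : F => (1 / 2 : ℝ) • y) = ⇑((1 / 2 : ℝ) • ContinuousLinearMap.id ℝ F) := rfl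
    rw [hΨ, ContinuousLinearMap.fderiv, sub_self, norm_zero]
    positivity
  fderiv_φ_le := fun g y _ _ => by
    rw [fderiv_fun_const, Pi.zero_apply, norm_zero]
    positivity
  b₀ := b / Real.log M
  b_eq := by field_simp
  R := 2
  δ_le_R := by norm_num
  θ' := 1 / 2
  θ'_nonneg := by norm_num
  θ'_lt_one := by norm_num
  contraction := fun g y y' _ _ _ => by
    rw [← smul_sub, norm_smul]; norm_num
  remainder_basin := fun g y _ _ => by simp only [sub_self, abs_zero]; positivity
  yW := yWc
  g₀ := 1
  g₀_pos := one_pos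
  continuousOn_yW := hyWc.continuousOn
  norm_yW_le := hyWn
  betaOf := fun g => κ / g ^ 2
  strictAntiOn_betaOf := by
    intro t ht t' ht' hlt
    simp only
    rw [div_lt_div_iff_of_pos_left hκ (by have := ht'.1; positivity) (by have := ht.1; positivity)]
    exact pow_lt_pow_left₀ hlt ht.1.le two_ne_zero
  continuousOn_betaOf := by
    refine continuousOn_of_forall_continuousAt fun t ht => ?_
    have : t ^ 2 ≠ 0 := by have := ht.1; positivity
    fun_prop (disch := assumption)
  κ := κ
  κ_pos := hκ
  K := 0
  betaOf_sub_le := fun g _ => by simp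
  mom := X
  mom_step := fun g y _ _ S n f => h4a (g, y) S n f
  mom_wilson := h4b
  continuousOn_mom := fun S n f hf => (h4c S n f hf).continuousOn

/-- **Even `M` is dead weight for the line's object too**: for every compact `G`, every `r` and every
EVEN `M ≥ 2`, `CurvatureChart G r M` is inhabited by the thin chart on `F = ℝ` carrying the curvature
restriction of the disprover's functional `expectE` (zero renormalisation-group content). [folklore] -/
theorem nonempty_curvatureChart_of_even (hM : 2 ≤ M) (hMe : Even M) :
    Nonempty (CurvatureChart G r M) := by
  have hlog : 0 < Real.log M := Real.log_pos (by exact_mod_cast hM)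
  refine ⟨thinChart r M ℝ hlog one_pos hlog (fun _ => (1 : ℝ)) continuous_const
    (fun g _ => by norm_num)
    (fun p S n f => expectE r M hM n (fun _ => r.curvature) p S f) ?_ ?_ ?_⟩
  · intro p S n f
    exact expectE_step r M hM n _ p S f
  · intro g hg L n f
    rw [expectE_wilson r M hM hMe n _ hg.1 1 L f, wilsonCentredSchwinger_cInd, if_pos fun _ => rfl]
  · intro S n f _
    exact continuous_expectE r M hM n _ S f

/-- **The thin over-tuned curvature chart**: for odd `M ≥ 2` and every compact `G`, `r`, uniform
over-tuned triviality at some slope `B > 0` (the RG-free statement every inhabitant of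
`BalabanBanachStep G r M` forces, drefute gen 2) already inhabits `CurvatureChart G r M`: thin chart on
`F = ℝ × ℝ`, Wilson embedding `g ↦ (1, g)`, `betaOf g = (B / log M)/g²`, curvature functional
`Negative.expectC`.  No convexity, no Brascamp–Lieb, no regulator, no `R`-operation. [folklore] -/
theorem nonempty_curvatureChart_of_uniformOverTuned (hMo : Odd M) (hM : 2 ≤ M) {B : ℝ} (hB : 0 < B)
    (hUOT : ∀ (B' : ℝ) (L m : ℕ) (h : Fin (m + 1) → 𝓢(EuclideanSpace ℝ (Fin 4), ℝ)),
      IsOffDiagonal (SchwartzMap.tensorFin (m + 1) fun i => ofRealTest (h i)) →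
      ∀ ε > 0, ∃ k₀ : ℕ, ∀ k ≥ k₀, ∀ β : ℝ, B * k - B' ≤ β →
        |wilsonCentredSchwinger r.ρ β ((M ^ k * (2 * L + 1) - 1) / 2) (fun _ => 1) (m + 1)
          (fun _ => r.curvature) (fun i => (blockDilate M)^[k] (h i))| ≤ ε) :
    Nonempty (CurvatureChart G r M) := by
  have hlog : 0 < Real.log M := Real.log_pos (by exact_mod_cast hM)
  have hκ : 0 < B / Real.log M := div_pos hB hlog
  refine ⟨thinChart r M (ℝ × ℝ) hlog hκ hlog (fun g => ((1 : ℝ), g)) (by fun_prop)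
    (fun g hg => ?_)
    (fun p S n f => expectC r M (B / Real.log M) hM n (fun _ => r.curvature) p S f) ?_ ?_ ?_⟩
  · rw [Prod.norm_def, Real.norm_eq_abs, Real.norm_eq_abs, abs_one, abs_of_nonneg hg.1]
    exact max_le (by norm_num) (hg.2.trans (by norm_num))
  · intro p S n f
    exact expectC_step r M _ hM n _ p S f
  · intro g hg L n f
    rw [expectC_wilson r M _ hM hMo n _ hg L f, wilsonCentredSchwinger_cInd, if_pos fun _ => rfl]
  · intro S n f hf
    exact continuous_expectC r M hM hB hUOT n _ S f hf

/-- **`CurvatureChart G r M` is inhabited iff `BalabanBanachStep G r M` is** — for EVERY block factor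
`M`, every compact `G` and every `r`: the `C^{1,1}` regularity and the curvature-only realisation
that distinguish the line's output type cost a junk inhabitant nothing. (⇒ the species reduction
`toStep`; ⇐ `M ≥ 2` from the inhabitant, even `M` by `nonempty_curvatureChart_of_even`, odd `M` by
`Negative.uniformOverTuned_of_nonempty` and `nonempty_curvatureChart_of_uniformOverTuned`.) [folklore] -/
theorem nonempty_curvatureChart_iff :
    Nonempty (CurvatureChart G r M) ↔ Nonempty (BalabanBanachStep G r M) := by
  refine ⟨fun ⟨X⟩ => ⟨X.toStep⟩, fun h => ?_⟩
  obtain ⟨T⟩ := h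
  have hM : 2 ≤ M := T.two_le_M
  rcases Nat.even_or_odd M with he | ho
  · exact nonempty_curvatureChart_of_even r M hM he
  · obtain ⟨B, hB, hU⟩ := uniformOverTuned_of_nonempty r M ho ⟨T⟩
    exact nonempty_curvatureChart_of_uniformOverTuned r M ho hM hB hU

/-- **The conclusion of `stub_convexFibreChart` is EQUIVALENT to the crux** (kernel-checked, no stub
used): the load-bearing stub, given its four inputs, is a costume of `BalabanStepParabolic`. [folklore] -/
theorem convexFibreChart_conclusion_iff_crux :
    (∀ (G : Type) [Group G] [TopologicalSpace G] [IsTopologicalGroup G] [CompactSpace G],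
      IsCompactSimpleLieGroup G →
      letI : MeasurableSpace G := borel G
      haveI : BorelSpace G := ⟨rfl⟩
      ∀ (r : LatticeRep G), ∃ M₀ : ℕ, ∀ M : ℕ, M₀ ≤ M → Nonempty (CurvatureChart G r M)) ↔
    Summit.QuantumFields.YangMills.Theses.ParabolicTrajectory.BalabanStepParabolic := by
  constructor
  · intro h G _ _ _ _ hG r
    letI : MeasurableSpace G := borel G
    haveI : BorelSpace G := ⟨rfl⟩
    obtain ⟨M₀, hM₀⟩ := h G hG r
    exact ⟨M₀, fun M hM => (nonempty_curvatureChart_iff r M).1 (hM₀ M hM)⟩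
  · intro h G _ _ _ _ hG r
    letI : MeasurableSpace G := borel G
    haveI : BorelSpace G := ⟨rfl⟩
    obtain ⟨M₀, hM₀⟩ := h G hG r
    exact ⟨M₀, fun M hM => (nonempty_curvatureChart_iff r M).2 (hM₀ M hM)⟩

/-- **The conclusion of `stub_convexFibreChart` is false modulo the face-contact hypothesis**
(cdisprove gen 4: `Negative.balabanStepParabolic_false_of_faceContactHypothesis`). [folklore] -/
theorem convexFibreChart_conclusion_false_of_faceContactHypothesis (h : FaceContactHypothesis) :
    ¬ (∀ (G : Type) [Group G] [TopologicalSpace G] [IsTopologicalGroup G] [CompactSpace G],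
      IsCompactSimpleLieGroup G →
      letI : MeasurableSpace G := borel G
      haveI : BorelSpace G := ⟨rfl⟩
      ∀ (r : LatticeRep G), ∃ M₀ : ℕ, ∀ M : ℕ, M₀ ≤ M → Nonempty (CurvatureChart G r M)) :=
  fun hc => balabanStepParabolic_false_of_faceContactHypothesis h
    (convexFibreChart_conclusion_iff_crux.1 hc)

/-- **Stub 5 is false modulo `FaceContactHypothesis` once its four inputs hold** (the planner's gen-2
audit rates stubs 1–4 true as typed; a false input would kill the line at that input instead). [folklore] -/
theorem stub_convexFibreChart_false_of_inputs (h : FaceContactHypothesis)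
    (h₁ : Stub.stub_plaquetteConvexWindow) (h₂ : Stub.stub_constrainedAxialGap)
    (h₃ : Stub.stub_noDerivativeLoss) (h₄ : Stub.stub_convexCovarianceDecay) :
    ¬ Stub.stub_convexFibreChart :=
  fun h₅ => convexFibreChart_conclusion_false_of_faceContactHypothesis h (h₅ h₁ h₂ h₃ h₄)

end Certificate

end Summit.QuantumFields.YangMills.Cruxes.BalabanStepParabolic.LogconcaveFibresNoDerivativeLoss

end
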